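import Mathlib.RingTheory.Polynomial.Quotient
import Mathlib.RingTheory.Polynomial.Basic
import Mathlib.Algebra.Polynomial.Lifts
import Mathlib.Algebra.Polynomial.Div
import Mathlib.Algebra.Polynomial.FieldDivision
import Mathlib.RingTheory.Ideal.Quotient.Basic
import Mathlib.Algebra.CharP.Lemmas
import Mathlib.RingTheory.PrincipalIdealDomain
import Mathlib.RingTheory.Nilpotent.Basic
import Mathlib.RingTheory.LocalRing.ResidueField.Basic
import Mathlib.RingTheory.Coprime.Lemmas
import HarnessLib

/-!
# Frobenius closedness of parameter ideals ascends along `A → A[X]` (pure polynomial algebra)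

[OURS · L1 W4.5a · res-L1-w45a-lead-1 gen 4] Support file (`--supports stmt-ResolutionOfSingularities-15315 --as helper`) for the
crux `FrobeniusLadder.FInjectiveMacaulayfication`; NOT a statement of any manuscript; AI-written, weaker than expert review.

This is the ALGEBRA CORE of the cylinder-support lemma L1′ `clause_polynomialLocalization` (the CM + F-injective clause of
the crux ascends from a Noetherian local ring `(A, 𝔪)` of characteristic `p` to `A[X]_Q` for every prime `Q` of `A[X]` lying
over `𝔪`). Fix `q = p^e`, an ideal `J ⊆ A` and an ideal `J_q ⊆ A` such that `a^q ∈ J_q ⇒ a ∈ J` (in the application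
`J = (x₁,…,x_d)` is a parameter ideal and `J_q = (x₁^q,…,x_d^q)` its Frobenius power, Frobenius closed by hypothesis).

* `mem_map_C_of_pow_mem` — the same implication for `J·A[X]` and `J_q·A[X]`: `f^q ∈ J_q A[X] ⇒ f ∈ J A[X]`
  (Horner induction: `(r + a X^0 …)`; the constant coefficient of `f^q` is `f(0)^q`).
* `mem_nonZeroDivisors_of_isUnit_coeff` — a polynomial with a unit coefficient is a non-zero-divisor (McCoy).
* `mem_map_C_of_mul_pow_mem` — CASE `Q = 𝔪A[X]`: `u ∉ 𝔪A[X]`, `u·f^q ∈ J_q A[X]` ⇒ `f ∈ J A[X]`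
  (reduce modulo `J_q`: `ū` has a unit coefficient, hence is a non-zero-divisor).
* `mem_map_C_sup_span_of_mul_pow_mem` — CASE `Q = 𝔪A[X] + (g)`, `g` monic with irreducible reduction `ḡ ∈ k[X]`:
  `ḡ ∤ ū`, `u·f^q ∈ J_q A[X] + (g^q)`, `𝔪^N ⊆ J_q` ⇒ `f ∈ J A[X] + (g)`. Proof: divide `f` by `g` (remainder `r`,
  `deg r < deg g`); Bezout in `k[X]` (`αu + βg^q = 1 + μ`, `μ ∈ 𝔪A[X]`, and `1 + μ` is a unit modulo
  `I_q = J_q A[X] + (g^q)` because `μ^N ∈ I_q`) gives `r^q ∈ I_q`; reducing modulo `J_q`, `r̄^q` is a multiple of the monic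
  `ḡ^q` of degree `q·deg g > deg r^q`, so `r̄^q = 0`, i.e. `r^q ∈ J_q A[X]`, and `r ∈ J A[X]` by the first lemma.
No separability of `ḡ` is used anywhere.
-/

-- single-problem summit: the doubled namespace component `ResolutionOfSingularities` is forced
set_option linter.dupNamespace false

namespace Summit.ResolutionOfSingularities.ResolutionOfSingularities.Theorems.FInjectiveMacaulayfication.PolynomialFrobeniusCore

open Polynomial

variable {A : Type*} [CommRing A]

/-- **`J` Frobenius closed w.r.t. `J_q` ⇒ `J·A[X]` Frobenius closed w.r.t. `J_q·A[X]`**: if `a^(p^e) ∈ J_q ⇒ a ∈ J` in `A`,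
then `f^(p^e) ∈ J_q A[X] ⇒ f ∈ J A[X]` in `A[X]` (Horner induction; in characteristic `p` the `p^e`-th power is additive,
the constant coefficient of `f^(p^e)` is `f(0)^(p^e)`, and `(f·X)^(p^e) = f^(p^e)·X^(p^e)`). [folklore] -/
theorem mem_map_C_of_pow_mem (p e : ℕ) [Fact p.Prime] [CharP A p] (J Jq : Ideal A)
    (hJ : ∀ a : A, a ^ p ^ e ∈ Jq → a ∈ J) :
    ∀ f : A[X], f ^ p ^ e ∈ Jq.map (C : A →+* A[X]) → f ∈ J.map (C : A →+* A[X]) := by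
  intro f
  induction f using Polynomial.recOnHorner with
  | M0 => intro _; exact Ideal.zero_mem _
  | MC g a hg0 _ ih =>
    intro h
    -- the constant coefficient of `(g + C a)^q` is `a^q`
    have hq : (g + C a) ^ p ^ e = g ^ p ^ e + C (a ^ p ^ e) := by
      rw [add_pow_char_pow, C_pow]
    rw [hq] at h
    have hcoeff : ∀ n, (g ^ p ^ e + C (a ^ p ^ e)).coeff n ∈ Jq := Ideal.mem_map_C_iff.mp h
    have h0 : (g ^ p ^ e).coeff 0 = 0 := by
      rw [coeff_zero_eq_eval_zero, eval_pow, ← coeff_zero_eq_eval_zero, hg0, zero_pow]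
      exact pow_ne_zero _ (Fact.out : p.Prime).ne_zero
    have ha : a ^ p ^ e ∈ Jq := by
      have := hcoeff 0
      rwa [coeff_add, h0, zero_add, coeff_C_zero] at this
    have haJ : C a ∈ J.map (C : A →+* A[X]) := Ideal.mem_map_of_mem _ (hJ a ha)
    have hgq : g ^ p ^ e ∈ Jq.map (C : A →+* A[X]) := by
      have hC : C (a ^ p ^ e) ∈ Jq.map (C : A →+* A[X]) := Ideal.mem_map_of_mem _ ha
      have := Ideal.sub_mem _ h hC
      rwa [add_sub_cancel_right] at this
    exact Ideal.add_mem _ (ih hgq) haJ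
  | MX g _ ih =>
    intro h
    have hq : (g * X) ^ p ^ e = g ^ p ^ e * X ^ p ^ e := mul_pow _ _ _
    rw [hq] at h
    have hcoeff : ∀ n, (g ^ p ^ e * X ^ p ^ e).coeff n ∈ Jq := Ideal.mem_map_C_iff.mp h
    have hgq : g ^ p ^ e ∈ Jq.map (C : A →+* A[X]) := by
      refine Ideal.mem_map_C_iff.mpr fun n => ?_
      have := hcoeff (n + p ^ e)
      rwa [coeff_mul_X_pow] at this
    exact Ideal.mul_mem_right _ _ (ih hgq)

/-- **McCoy, unit-coefficient form**: a polynomial with some unit coefficient is a non-zero-divisor. [folklore] -/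
theorem mem_nonZeroDivisors_of_isUnit_coeff {B : Type*} [CommRing B] (v : B[X]) {i : ℕ} (hi : IsUnit (v.coeff i)) :
    v ∈ nonZeroDivisors B[X] := by
  refine Polynomial.mem_nonZeroDivisors_iff.mpr fun a ha => ?_
  have h : a * v.coeff i = 0 := by
    have := congrArg (fun w : B[X] => w.coeff i) ha
    simpa only [coeff_smul, smul_eq_mul, coeff_zero] using this
  exact (hi.mul_left_eq_zero).mp h

/-- The kernel of `A[X] → (A/I)[X]` is `I·A[X]`. [folklore] -/
theorem ker_mapRingHom_mk (I : Ideal A) :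
    RingHom.ker (mapRingHom (Ideal.Quotient.mk I)) = I.map (C : A →+* A[X]) := by
  rw [Polynomial.ker_mapRingHom, Ideal.mk_ker]

/-- **Case `Q = 𝔪A[X]`.** Let `(A, 𝔪)` be local of characteristic `p`, `q = p^e`, and `J, J_q ⊆ A` ideals with
`a^q ∈ J_q ⇒ a ∈ J`. If `u ∉ 𝔪A[X]` and `u·f^q ∈ J_q A[X]`, then `f ∈ J A[X]`: modulo `J_q`, `ū` has a unit coefficient
and is therefore a non-zero-divisor, so `f^q ∈ J_q A[X]`. [folklore] -/
theorem mem_map_C_of_mul_pow_mem (p e : ℕ) [Fact p.Prime] [CharP A p] [IsLocalRing A] (J Jq : Ideal A)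
    (hJ : ∀ a : A, a ^ p ^ e ∈ Jq → a ∈ J) (f u : A[X])
    (hu : u ∉ (IsLocalRing.maximalIdeal A).map (C : A →+* A[X]))
    (h : u * f ^ p ^ e ∈ Jq.map (C : A →+* A[X])) : f ∈ J.map (C : A →+* A[X]) := by
  -- some coefficient of `u` is a unit
  have hcoef : ∃ i, IsUnit (u.coeff i) := by
    by_contra hno
    push Not at hno
    exact hu (Ideal.mem_map_C_iff.mpr fun n => (IsLocalRing.mem_maximalIdeal _).mpr (hno n))
  obtain ⟨i, hi⟩ := hcoef
  -- reduce modulo `J_q`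
  set π : A[X] →+* (A ⧸ Jq)[X] := mapRingHom (Ideal.Quotient.mk Jq) with hπ
  have hπu : π u ∈ nonZeroDivisors (A ⧸ Jq)[X] := by
    refine mem_nonZeroDivisors_of_isUnit_coeff (π u) (i := i) ?_
    rw [hπ, coe_mapRingHom, coeff_map]
    exact hi.map _
  have hzero : π (u * f ^ p ^ e) = 0 := by
    rw [← RingHom.mem_ker, hπ, ker_mapRingHom_mk]
    exact h
  have hfq : π (f ^ p ^ e) = 0 := by
    rw [map_mul] at hzero
    exact (mul_left_mem_nonZeroDivisors_eq_zero_iff hπu).mp hzero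
  refine mem_map_C_of_pow_mem p e J Jq hJ f ?_
  rw [← ker_mapRingHom_mk, RingHom.mem_ker]
  exact hfq

/-- **Case `Q = 𝔪A[X] + (g)`, `g` monic with irreducible reduction.** Let `(A, 𝔪, k)` be local of characteristic `p`,
`q = p^e`, `J, J_q ⊆ A` ideals with `a^q ∈ J_q ⇒ a ∈ J`, `𝔪^N ⊆ J_q` and `J_q ≠ A`. Let `g ∈ A[X]` be monic with
irreducible image `ḡ ∈ k[X]`, and `u ∈ A[X]` with `ḡ ∤ ū`. If `u·f^q ∈ J_q A[X] + (g^q)` then `f ∈ J A[X] + (g)`.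
Division by `g`, Bezout in `k[X]`, nilpotence of the defect `μ ∈ 𝔪A[X]` modulo `J_q A[X] + (g^q)`, a degree comparison
modulo `J_q`, and `mem_map_C_of_pow_mem`. NO separability of `ḡ` is needed. [folklore] -/
theorem mem_map_C_sup_span_of_mul_pow_mem (p e : ℕ) [Fact p.Prime] [CharP A p] [IsLocalRing A] (J Jq : Ideal A)
    (hJ : ∀ a : A, a ^ p ^ e ∈ Jq → a ∈ J) (N : ℕ) (hN : IsLocalRing.maximalIdeal A ^ N ≤ Jq) (hJq : Jq ≠ ⊤)
    (g : A[X]) (hg : g.Monic) (hirr : Irreducible (g.map (IsLocalRing.residue A)))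
    (f u : A[X]) (hu : ¬ g.map (IsLocalRing.residue A) ∣ u.map (IsLocalRing.residue A))
    (h : u * f ^ p ^ e ∈ Jq.map (C : A →+* A[X]) ⊔ Ideal.span {g ^ p ^ e}) :
    f ∈ J.map (C : A →+* A[X]) ⊔ Ideal.span {g} := by
  haveI : Nontrivial (A ⧸ Jq) := Ideal.Quotient.nontrivial_iff.mpr hJq
  set q : ℕ := p ^ e with hq
  have hq0 : q ≠ 0 := pow_ne_zero _ (Fact.out : p.Prime).ne_zero
  set Iq : Ideal A[X] := Jq.map (C : A →+* A[X]) ⊔ Ideal.span {g ^ q} with hIq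
  -- `g ≠ 1` (its reduction is irreducible, hence not a unit)
  have hg1 : g ≠ 1 := by
    rintro rfl
    rw [Polynomial.map_one] at hirr
    exact hirr.not_isUnit isUnit_one
  -- division by the monic `g`: `f = r + g·s`, `deg r < deg g`
  set r : A[X] := f %ₘ g with hr
  set s : A[X] := f /ₘ g with hs
  have hf : r + g * s = f := modByMonic_add_div f g
  have hrdeg : r.natDegree < g.natDegree := natDegree_modByMonic_lt f hg hg1
  -- it suffices to put `r` in `J A[X]`
  suffices hrJ : r ∈ J.map (C : A →+* A[X]) by
    rw [← hf]
    exact Ideal.add_mem _ (Ideal.mem_sup_left hrJ) (Ideal.mem_sup_right (Ideal.mem_span_singleton'.mpr ⟨s, mul_comm s g⟩))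
  -- `u·r^q ∈ I_q`
  have hur : u * r ^ q ∈ Iq := by
    have hr' : r = f - g * s := by rw [← hf]; ring
    have hrq : r ^ q = f ^ q - g ^ q * s ^ q := by
      rw [hr', hq, sub_pow_char_pow, mul_pow]
    rw [hrq, mul_sub]
    refine Ideal.sub_mem _ h (Ideal.mem_sup_right ?_)
    exact Ideal.mem_span_singleton'.mpr ⟨u * s ^ q, by ring⟩
  -- Bezout in `k[X]`: `ḡ^q` and `ū` are coprime
  set k := IsLocalRing.ResidueField A
  set π : A[X] →+* k[X] := mapRingHom (IsLocalRing.residue A) with hπ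
  have hπsurj : Function.Surjective π := Polynomial.map_surjective _ IsLocalRing.residue_surjective
  have hker : RingHom.ker π = (IsLocalRing.maximalIdeal A).map (C : A →+* A[X]) := by
    rw [hπ, Polynomial.ker_mapRingHom, IsLocalRing.ker_residue]
  have hcop : IsCoprime (π g ^ q) (π u) :=
    ((hirr.coprime_iff_not_dvd).mpr hu).pow_left
  obtain ⟨α, β, hαβ⟩ := hcop
  obtain ⟨α', rfl⟩ := hπsurj α
  obtain ⟨β', rfl⟩ := hπsurj β
  -- the defect `μ := α' g^q + β' u - 1` lies in `𝔪A[X]`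
  set μ : A[X] := α' * g ^ q + β' * u - 1 with hμ
  have hμker : μ ∈ (IsLocalRing.maximalIdeal A).map (C : A →+* A[X]) := by
    rw [← hker, RingHom.mem_ker, hμ, map_sub, map_add, map_mul, map_mul, map_pow, map_one, hαβ, sub_self]
  -- `μ^N ∈ I_q`
  have hμN : μ ^ N ∈ Iq := by
    have h1 : μ ^ N ∈ ((IsLocalRing.maximalIdeal A).map (C : A →+* A[X])) ^ N := Ideal.pow_mem_pow hμker N
    rw [← Ideal.map_pow] at h1
    exact Ideal.mem_sup_left (Ideal.map_mono hN h1)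
  -- `(1 + μ)·r^q ∈ I_q`
  have h1μ : (1 + μ) * r ^ q ∈ Iq := by
    have : (1 + μ) * r ^ q = α' * (g ^ q * r ^ q) + β' * (u * r ^ q) := by rw [hμ]; ring
    rw [this]
    refine Ideal.add_mem _ (Ideal.mul_mem_left _ _ (Ideal.mem_sup_right ?_)) (Ideal.mul_mem_left _ _ hur)
    exact Ideal.mem_span_singleton'.mpr ⟨r ^ q, by ring⟩
  -- hence `r^q ∈ I_q` (`1 + μ` is a unit modulo `I_q`)
  have hrq : r ^ q ∈ Iq := by
    have hunit : IsUnit (Ideal.Quotient.mk Iq (1 + μ)) := by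
      rw [map_add, map_one]
      exact IsNilpotent.isUnit_one_add ⟨N, by rw [← map_pow, Ideal.Quotient.eq_zero_iff_mem]; exact hμN⟩
    have hz : Ideal.Quotient.mk Iq (1 + μ) * Ideal.Quotient.mk Iq (r ^ q) = 0 := by
      rw [← map_mul, Ideal.Quotient.eq_zero_iff_mem]
      exact h1μ
    rw [← Ideal.Quotient.eq_zero_iff_mem]
    exact (hunit.mul_right_eq_zero).mp hz
  -- degree comparison modulo `J_q`: `r^q ∈ J_q A[X]`
  have hrqJ : r ^ q ∈ Jq.map (C : A →+* A[X]) := by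
    obtain ⟨j, hj, c', hc', hsum⟩ := Submodule.mem_sup.mp hrq
    obtain ⟨c, rfl⟩ := Ideal.mem_span_singleton'.mp hc'
    set ψ : A[X] →+* (A ⧸ Jq)[X] := mapRingHom (Ideal.Quotient.mk Jq) with hψ
    have hψj : ψ j = 0 := by
      rw [← RingHom.mem_ker, hψ, ker_mapRingHom_mk]
      exact hj
    have hψr : ψ (r ^ q) = ψ c * ψ g ^ q := by
      rw [← hsum, map_add, hψj, zero_add, map_mul, map_pow]
    have hψg : (ψ g).Monic := by rw [hψ, coe_mapRingHom]; exact hg.map _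
    have hψgq : (ψ g ^ q).Monic := hψg.pow q
    -- degrees
    have hdeg_r : (ψ (r ^ q)).natDegree < q * g.natDegree := by
      rw [hψ, coe_mapRingHom]
      calc (Polynomial.map (Ideal.Quotient.mk Jq) (r ^ q)).natDegree ≤ (r ^ q).natDegree := natDegree_map_le
        _ ≤ q * r.natDegree := natDegree_pow_le
        _ < q * g.natDegree := Nat.mul_lt_mul_of_pos_left hrdeg (Nat.pos_of_ne_zero hq0)
    have hψc : ψ c = 0 := by
      by_contra hc0
      have hdeg : (ψ c * ψ g ^ q).natDegree = (ψ c).natDegree + q * g.natDegree := by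
        rw [mul_comm, hψgq.natDegree_mul' hc0, hψg.natDegree_pow, add_comm]
        rw [hψ, coe_mapRingHom, hg.natDegree_map]
      have := hdeg_r
      rw [hψr, hdeg] at this
      omega
    rw [← ker_mapRingHom_mk Jq, RingHom.mem_ker, ← hψ, hψr, hψc, zero_mul]
  exact mem_map_C_of_pow_mem p e J Jq hJ r hrqJ

end Summit.ResolutionOfSingularities.ResolutionOfSingularities.Theorems.FInjectiveMacaulayfication.PolynomialFrobeniusCore
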